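import Literature.NumberTheory.Automorphic.Liu2021.AppendixC.RestOne
import Literature.AlgebraicGeometry.ComplexMultiplication.CMTypeEigenlineCriterion
import Literature.AlgebraicGeometry.ComplexMultiplication.RationalCMStructureBaseChange
import Literature.AlgebraicGeometry.Motives.AbelianVarietyProjective
import HarnessLib

/-!
# Liu 2021, Def. 4.5 (2) at the one-object instance: `A_μ ⊗_E ℂ` is of CM type

Topic `NumberTheory/Automorphic/Liu2021/AppendixC`, namespace `…AppendixC.RestOne`.  ONE THEOREM (no definition, no named fact, no
instance, no `sorry`).  Cell `hodgecm-mathlib`, memo `A-plan/VI1-AFTER-N9.md` §3 (g-iii) / §5 W3 (A-plan1 g9): the CM side of the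
pairs at which the `hLiu418` cone consumes Faltings–Tate bijectivity (`Liu2021/AppendixC/EtaleFaltingsIsotypic.faltingsIsotypic_of_isInducedBy`,
hypothesis `hF : ∀ K obj, faltings_tate_bijective (C.A K) (AμOne … obj) ℓ`).

For the chosen object `D_μ ∈ 𝒜(μ)` of [Liu2021] Def. 4.5 (2) («`A_μ` is an abelian variety over `E` … `i_μ : M_μ → End_E(A_μ)_ℚ` … such
that `[M_μ : ℚ] = 2 dim A_μ`», FJcycle.tex l. 1944–1948; ★ `RestOne.AμOne` / `iOne` / `hdimOne`), the complexification
`A_μ ⊗_E ℂ` (along ANY `ℂ`-algebra structure on `E`) is of CM type in the sense of ★ `Milne1999.IsOfCMType` ([Milne1999] §2 p. 54: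
«`End⁰(A)` contains a commutative semisimple `ℚ`-algebra of degree `2 dim A`»): compose `i_μ` with ★ `endAlgebraBaseChange :
End⁰(A_μ) → End⁰(A_μ ⊗ ℂ)` ([MumfordAV1970] §19) and apply ★ `ComplexMultiplication.isOfCMType_of_ringHom` with
`dim (A_μ ⊗ ℂ) = dim A_μ` (★ `dim_baseChange`); `M_μ` is a number field (★ `IsConjugateSymplectic.numberField_muAlgValueField`).
Consumer: with (N9) ★ `faltings_tate_bijective_of_isOfCMType_of_thm18_6` this discharges `hF` at every pair whose Albanese side is of
CM type over `ℂ` (memo VI1-AFTER-N9 §2; books there, not here).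

## References
* [Liu2021] Y. Liu, *Fourier–Jacobi cycles and arithmetic relative trace formula*, Camb. J. Math. 9 (2021), Def. 4.5 (2) (FJcycle.tex
  l. 1944–1950), Prop. 4.6 (1) (l. 1966–1969), proof of Thm. 4.18 (l. 2232).
* [Milne1999] J. S. Milne, *Lefschetz motives and the Tate conjecture*, Compositio Math. 117 (1999), §2 p. 54 (CM type over `ℂ`).
* [MumfordAV1970] D. Mumford, *Abelian Varieties* (1970), §19 (`End⁰` and base change).
-/

noncomputable section

open CategoryTheory NumberField
open Literature.AlgebraicGeometry.Motives (AbelianVariety)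
open Literature.AlgebraicGeometry.Motives.AbelianVariety (endAlgebra)
open Literature.AlgebraicGeometry.Milne1999 (IsOfCMType)

namespace Literature.NumberTheory.Automorphic.Liu2021.AppendixC.RestOne

variable {E : Type} [Field E] [NumberField E] [IsCMField E]
variable {L : Type} [Field L] [NumberField L] [IsGalois ℚ L] (φ : E →ₐ[ℚ] L) (ι : L →+* ℂ)
variable {μ : IdeleClassGroup E →ₜ* Circle} (hμ : IdeleClassGroup.IsConjugateSymplectic E μ)
  (hw : IdeleClassGroup.HasWeight E μ 1) (Car : Def45.Carriers E μ)

/-- **`A_μ ⊗_E ℂ` is of CM type** ([Liu2021] Def. 4.5 (2) read through [Milne1999] §2): for the chosen object `D_μ ∈ 𝒜(μ)` at the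
instance (★ `AμOne`, with `i_μ : M_μ →+* End⁰(A_μ)` = ★ `iOne` and `[M_μ : ℚ] = 2 dim A_μ` = ★ `hdimOne`) and ANY `ℂ`-algebra
structure on `E`, `Milne1999.IsOfCMType ((AμOne … D).baseChange ℂ)` — the number field `M_μ` maps into `End⁰(A_μ ⊗ ℂ)` through
★ `endAlgebraBaseChange`, and `dim` is invariant under base change (★ `dim_baseChange`), so ★ `isOfCMType_of_ringHom` applies.
[cite: Liu2021, Def. 4.5 (2) (FJcycle.tex l. 1944–1948)] [cite: Milne1999, §2 p. 54] [cite: MumfordAV1970, §19] -/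
theorem isOfCMType_baseChange_aμOne [Algebra E ℂ] (D : ObjOne φ ι hμ hw Car) :
    IsOfCMType ((AμOne φ ι hμ hw Car D).baseChange ℂ) := by
  haveI := hμ.numberField_muAlgValueField
  refine Literature.AlgebraicGeometry.ComplexMultiplication.isOfCMType_of_ringHom
    ((AbelianVariety.endAlgebraBaseChange ℂ (AμOne φ ι hμ hw Car D)).toRingHom.comp (iOne φ ι hμ hw Car D)) ?_
  rw [AbelianVariety.dim_baseChange]
  exact hdimOne φ ι hμ hw Car D

end Literature.NumberTheory.Automorphic.Liu2021.AppendixC.RestOne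

end
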